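import Literature.MathematicalPhysics.QuantumFieldTheory.Balaban1983to89.B9Thm312WholeLeafCompletePairM
import Literature.MathematicalPhysics.QuantumFieldTheory.Balaban1983to89.B9Thm312WholeBlocksPairMB
import Literature.MathematicalPhysics.QuantumFieldTheory.Balaban1983to89.B9Thm312WholeLeafRelHZ

/-!
# `Balaban1983to89.B9Thm312WholeLeafCompletePairMBZ` (= `…PairMB` with the H-letters `LettersHZ ∕ LettersHHZ` through a coarse intermediate class `bZ`, R1-cls) — [B9] Theorem 3.12 (p. 423) AS THE WHOLE PRINTED LEAF `B9.Thm312Printed` ON THE PAIR-M FACE,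
# WITH THE β∕ε-INDEXED STEP SCHEMA `StepDirB` (the twin of `B9Thm312WholeLeafCompletePairM.thm312Printed_completePairM`; located remarks
# U2 ∕ U3 of the seat's step files, referee WATCH-A6-N06-STEPDIR-EPSUNIFORM)

T. Bałaban, *Propagators for lattice gauge theories in a background field*, Commun. Math. Phys. **99** (1985) 389–434
[`Balaban1985BackgroundPropagators`, "B9"]; [4] = T. Bałaban, *Propagators and renormalization transformations for lattice
gauge theories. II*, Commun. Math. Phys. **96** (1984) 223–250 [`Balaban1984PropagatorsII`].

statement-level skeleton of published theorems with citation tags; proofs where landed; nothing here is a claim about the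
Yang–Mills mass gap

THE POINT.  `thm312Printed_completePairM` reads the Sect.-D step through `hstepC : … → StepDir … (θ_D·Mα₀) (θ_H·Mα₀) δ_K U ∧ StepL2 …` with ONE
number θ_H for every Hölder exponent β ∈ [0,1) of the probe members and every input exponent ε > 0 of the right-form members, and builds its
UNIFORM output constants from t_H = θ_H·a₁.  Print's Hölder ∕ input constants B₀(β), B′₀(ε) of Theorems 3.1 ∕ 3.3 depend on β resp. ε
(*"→ ∞ if β → 1"*, *"→ ∞ if ε → 0"*, pp. 397–398), and a derivation of the step from Theorem 3.3 for G₀ and the letters (3.131) ∕ (3.137)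
(`B9Thm312WholeDirB.stepDirB_of_letters3131LR`) delivers β∕ε-INDEXED step constants.  THIS FILE is the same leaf with
`hstepC : … → StepDirB … (θ_D·Mα₀) (fun β => θ_H β·Mα₀) (fun ε => θ_I ε·Mα₀) δ_K U ∧ StepL2 …` (θ_H, θ_I : ℝ → ℝ, non-negative on [0,1) resp.
(0,∞)): the output families of `B9.Thm312Printed` become B(β) = max(m·CL·e^{rρ_f}(B_h(β) + θ_H(β)a₁·2B₀·c), …), B′(ε) = e^{rρ_f}(B_i(ε) +
B_L·Λ_u·θ_I(ε)a₁·c), B′(ε,β) with θ_M(ε,β) = max(θ_H(β), θ_I(β+ε)) — print's β∕ε-dependent constants — via `B9Thm312WholeBlocksPairMB.holder_of_step_pairMB`;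
everything else (the L² block, the sup ∕ global entries, the (3.133) Hölder member, the pins) VERBATIM the PairM leaf.  Nothing of print asserted beyond the
hypothesis schemas; COUNT-NEUTRAL; N06 is NOT discharged; one finite lattice at a time; nothing continuum, nothing about the mass gap.  Cell `pub-ymgap`
(HUMAN RULING D-0062), Track A node N06 [B9], rows 20–21 (bundle F7), seat `pub-ymgap-dag-n06-l` (g12), 2026-08-27.
-/

namespace Literature.MathematicalPhysics.QuantumFieldTheory.Balaban1983to89.B9Thm312WholeLeafCompletePairMBZ

open Literature.MathematicalPhysics.QuantumFieldTheory.Balaban1983to89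
open Finset B6RandomWalk B6RandomWalkHom B9Thm34Ext B9Thm37Glue B9Thm37GlueCor36 B11SectG B9SectDSup B9SectDL2Decay
open B9Thm37AllNorms B9Thm37AllNormsInstances B9FromB6 B9FromB6ModelSignsOn B9SectBStepWhole B9Thm312Whole B9Thm312WholeLeaf
open B9Thm312WholeLeft B9Thm312WholeH B9Thm312WholeLeafLeftGlob B9Ineq347CoReading B9SectCDiffDict B9CoRealizesRel B9CoRealizesHRel
open B9RWSums343Holder B9RWSumsReadsRel B9RWSumsReadsNbr B9Ineq347 B9Thm312WholeClasses B9Thm312WholeHolder B9Thm312WholeL2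
open B9Thm312WholeBlocksRel B9Thm312WholeBlocksNbr B9Thm312WholeLeafAll B9Thm312WholeHHolder B9Thm312WholeHHolderNbr B9Thm312WholeLeafRelH
open B9RWSums346SecondDiff B9Thm312WholeLeafCompleteNbr B9Thm312WholeBlocksNbrRec B9RWSums344InputFam B9Thm312WholeDir
open B9Thm312WholeBlocksPairM B9Thm312WholeLeafCompletePairM B9Thm312WholeDirB B9Thm312WholeBlocksPairMB B9Thm312WholeHZ B9Thm312WholeLeafRelHZ

noncomputable section


/-! ## The leaf of row 20 with no displayed residual, pair-M face, β∕ε-indexed step constants -/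

section Family

variable {I : Type} {d : ℕ} {c35 : ℝ} {geo : I → B9.Geometry} {bg : I → B9.Backgrounds}
variable [∀ i, Fintype (geo i).Site] [∀ i, DecidableEq (geo i).Site]
variable {X Y Z W PX PY : I → Type} {P : Type} [∀ i, Fintype (X i)] [∀ i, DecidableEq (X i)] [∀ i, Fintype (Y i)]
  [∀ i, Fintype (Z i)] [∀ i, Fintype (W i)] [∀ i, Fintype (PX i)] [∀ i, Fintype (PY i)] [Fintype P]

omit [∀ i, Fintype (X i)] [∀ i, DecidableEq (X i)] [∀ i, Fintype (Y i)] [∀ i, Fintype (Z i)] [∀ i, Fintype (W i)]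
  [∀ i, Fintype (geo i).Site] [∀ i, DecidableEq (geo i).Site] [∀ i, Fintype (PX i)] [∀ i, Fintype (PY i)] [Fintype P] in
/-- Arithmetic of *"for α₀ sufficiently small"*: t ≧ 0 and m ≦ (2(t + 1))⁻¹ give tm ≦ ½. [folklore] -/
private theorem small_aux₁₅z {t m : ℝ} (ht : 0 ≤ t) (hm : m ≤ (2 * (t + 1))⁻¹) : t * m ≤ 1 / 2 := by
  have hpos : 0 < 2 * (t + 1) := by linarith
  have h1 : t * m ≤ t * (2 * (t + 1))⁻¹ := mul_le_mul_of_nonneg_left hm ht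
  have h2 : t * (2 * (t + 1))⁻¹ ≤ 1 / 2 := by
    rw [← div_eq_mul_inv, div_le_iff₀ hpos]
    linarith
  linarith
set_option maxHeartbeats 400000 in
/-- ★★ **THEOREM 3.12 AS THE WHOLE PRINTED LEAF `B9.Thm312Printed`, AT THE PINS, PAIR-M FACE, WITH THE β∕ε-INDEXED STEP SCHEMA** (p. 423;
the twin of `B9Thm312WholeLeafCompletePairM.thm312Printed_completePairM`).  Inputs: those of the PairM leaf VERBATIM except `hstepC : … → StepDirB …
(θ_D·Mα₀) (fun β => θ_H β·Mα₀) (fun ε => θ_I ε·Mα₀) δ_K U ∧ StepL2 …` with θ_H θ_I : ℝ → ℝ (`hθH : ∀ β ∈ [0,1), 0 ≤ θ_H β`, `hθI : ∀ ε > 0,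
0 ≤ θ_I ε`).  PROVED INSIDE: every member, as in the PairM leaf — the Hölder block by `B9Thm312WholeBlocksPairMB.holder_of_step_pairMB`, whose
output families are dominated per β ∕ ε by the families B(β) = max(max(m·CL·e^{rρ_f}(B_h β + θ_H β·a₁·2B₀·c), B_H β), 0), B′(ε) = max(e^{rρ_f}(B_i ε +
B_L·Λ_u·θ_I ε·a₁·c), 0), B′(ε,β) = max(CL·e^{rρ_f}(B_i2 ε β + (B_h β + θ_M·a₁·2B₀c)·Λ_u·θ_M·a₁·c), 0), θ_M = max(θ_H β, θ_I (β+ε)) — print's β∕ε-DEPENDENT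
constants (Theorem 3.1 p. 397: B₀(β), B′₀(ε), B′₀(ε,β)).  Nothing of print asserted beyond the hypothesis schemas.
[cite: Balaban1985BackgroundPropagators, Thm 3.12 pp.421–423 + (3.39)–(3.47) pp.397–398 + (3.126) p.420 + (3.129) p.421 + (3.132)–(3.133) p.422; Balaban1984PropagatorsII, (2.51)–(2.52) p.232 + Lemma 2.1 (2.60)–(2.61) p.234] -/
theorem thm312Printed_completePairMBZ (𝔬 : ∀ i, Ops (geo i) (bg i) (X i) (Y i) (Z i) (W i)) (R₀ : I → ℝ) (H₀ : I → Prop)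
    (𝔭 : ∀ i, HolderProbes (geo i) (bg i) (X i) (Y i) (PX i) (PY i))
    (bHX : ∀ i, ℝ → BlockNorm (toB6 (geo i) (R₀ i) (H₀ i)) (X i → ℝ))
    (Dd Dds : ∀ i, (bg i).Cfg → P → Module.End ℝ (X i → ℝ))
    (GD G₁ : ∀ i, B9.KernelFamily (geo i) (bg i)) (Hk H₁k : ∀ i, B9.HKernel (geo i) (bg i))
    (ev : ∀ i, (geo i).Loc → X i → ℝ) (evY : ∀ i, (geo i).Loc → Y i → ℝ) {PL : ∀ i, (geo i).Loc → Prop}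
    (Rel : ∀ i, (geo i).Site → (geo i).Site → Prop) [∀ i, DecidableRel (Rel i)] (m mN : ℕ)
    (r Cev CL θ₁ θD θ₂ r₁ B₀ B₂ δ₀ δK σ c ρ ρf a₁ M₁ ML B₃ δ₃ α Lc : ℝ) (Bh Bi Bq θH θI : ℝ → ℝ) (Bi2 : ℝ → ℝ → ℝ)
    (hθ₁ : 0 ≤ θ₁) (hθD : 0 ≤ θD) (hθH : ∀ β, 0 ≤ β → β < 1 → 0 ≤ θH β) (hθI : ∀ ε, 0 < ε → 0 ≤ θI ε) (hθ₂ : 0 ≤ θ₂) (hr₁ : 0 ≤ r₁) (hB₀ : 0 ≤ B₀) (hB₂ : 0 ≤ B₂) (hB₃ : 0 ≤ B₃)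
    (hσ : 0 ≤ σ) (hρ : 0 < ρ) (hρS : ρ ≤ δ₀) (hρδ : ρ + σ ≤ δK) (hρ₃ : ρ + σ ≤ δ₃) (hc : 0 ≤ c) (ha₁ : 0 < a₁) (hM₁ : 0 < M₁)
    (hα : α ≤ 1 / 2) (hα0 : 0 ≤ α) (hρf : 0 < ρf) (hρf1 : ρf + σ ≤ (1 - α) * ρ) (hρf2 : ρf + 2 * σ + α * ρ ≤ ρ)
    (hBh : ∀ β, 0 ≤ β → β < 1 → 0 ≤ Bh β) (hBi : ∀ ε, 0 < ε → ε ≤ 1 → 0 ≤ Bi ε)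
    (hBi2 : ∀ ε β, 0 < ε → ε ≤ 1 → 0 ≤ β → β < 1 → 0 ≤ Bi2 ε β) (hBq : ∀ β, 0 ≤ Bq β)
    (hCev : 0 ≤ Cev) (hCL1 : 1 ≤ CL)
    (hgeo : ∀ i, GeoOK (geo i)) (S : ∀ i, ModelSignsOn (geo i) (PL i))
    (hL1 : ∀ i, 1 ≤ (geo i).L) (hLle : ∀ i, (geo i).L ≤ Lc) (hLc : 1 ≤ Lc) (hη : ∀ i, 0 < (geo i).eta)
    (hrow : ∀ i, ML ≤ (geo i).M → RowSum (toB6 (geo i) (R₀ i) (H₀ i)) σ c)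
    (hL21 : ∀ δ : ℝ, 0 < δ → ∃ ML' c' : ℝ, Lemma21AboveG geo R₀ H₀ δ α ML' c')
    (hnbr : ∀ (i : I) (y : (geo i).Site), (nbr (geo i) r y).card ≤ mN)
    (hCL : ∀ (i : I) (a a' : (geo i).Site), (geo i).dist a a' ≤ r → (geo i).len a ≤ CL * (geo i).len a')
    (hsat : ∀ (i : I) (n : Fin 4) (B' δ' : ℝ),
      (∀ a a' b, Rel i a a' → maj342 (geo i) n B' δ' a b = maj342 (geo i) n B' δ' a' b) ∧
      (∀ a b b', Rel i b b' → maj342 (geo i) n B' δ' a b = maj342 (geo i) n B' δ' a b'))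
    (hmult : ∀ (i : I) (y' : (geo i).Site), (Finset.univ.filter (fun y'' => Rel i y'' y')).card ≤ m)
    (hRdist : ∀ (i : I) (a a' b : (geo i).Site), Rel i a a' → (geo i).dist a b = (geo i).dist a' b)
    (hRlen : ∀ (i : I) (a a' : (geo i).Site), Rel i a a' → (geo i).len a = (geo i).len a')
    (hcoR : ∀ (i : I) (U : (bg i).Cfg),
      CoRealizesRel (GD i) 0 U (Rel i) (𝔬 i).blk (𝔬 i).blk (ev i) ((𝔬 i).G U) ∧
      CoRealizesRel (GD i) 2 U (Rel i) (𝔬 i).blk (𝔬 i).blkY (evY i) ((𝔬 i).G U ∘ₗ (𝔬 i).Dstar U) ∧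
      CoRealizesRel (G₁ i) 0 U (Rel i) (𝔬 i).blk (𝔬 i).blk (ev i) ((𝔬 i).G1 U) ∧
      CoRealizesRel (G₁ i) 2 U (Rel i) (𝔬 i).blk (𝔬 i).blkY (evY i) ((𝔬 i).G1 U ∘ₗ (𝔬 i).Dstar U))
    (hco1R : ∀ (i : I) (U : (bg i).Cfg),
      CoRealizesRel (GD i) 1 U (Rel i) (𝔬 i).blkY (𝔬 i).blk (ev i) ((𝔬 i).D U ∘ₗ (𝔬 i).G U) ∧
      CoRealizesRel (G₁ i) 1 U (Rel i) (𝔬 i).blkY (𝔬 i).blk (ev i) ((𝔬 i).D U ∘ₗ (𝔬 i).G1 U))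
    (hcoHR : ∀ (i : I) (U : (bg i).Cfg),
      CoRealizesHRel (Hk i) 0 U d (Rel i) (𝔬 i).blk (𝔬 i).blkZ ((𝔬 i).Hm U) ∧
      CoRealizesHRel (Hk i) 1 U d (Rel i) (𝔬 i).blkY (𝔬 i).blkZ ((𝔬 i).D U ∘ₗ (𝔬 i).Hm U) ∧
      CoRealizesHRel (H₁k i) 0 U d (Rel i) (𝔬 i).blk (𝔬 i).blkZ ((𝔬 i).H1m U) ∧
      CoRealizesHRel (H₁k i) 1 U d (Rel i) (𝔬 i).blkY (𝔬 i).blkZ ((𝔬 i).D U ∘ₗ (𝔬 i).H1m U))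
    (hcoG : ∀ (i : I) (U : (bg i).Cfg),
      CoReadsGlob (GD i) 0 U (𝔬 i).blk (𝔬 i).blk (ev i) ((𝔬 i).G U) ∧
      CoReadsGlob (GD i) 1 U (𝔬 i).blkY (𝔬 i).blk (ev i) ((𝔬 i).D U ∘ₗ (𝔬 i).G U) ∧
      CoReadsGlob (GD i) 2 U (𝔬 i).blk (𝔬 i).blkY (evY i) ((𝔬 i).G U ∘ₗ (𝔬 i).Dstar U) ∧
      CoReadsGlob (G₁ i) 0 U (𝔬 i).blk (𝔬 i).blk (ev i) ((𝔬 i).G1 U) ∧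
      CoReadsGlob (G₁ i) 1 U (𝔬 i).blkY (𝔬 i).blk (ev i) ((𝔬 i).D U ∘ₗ (𝔬 i).G1 U) ∧
      CoReadsGlob (G₁ i) 2 U (𝔬 i).blk (𝔬 i).blkY (evY i) ((𝔬 i).G1 U ∘ₗ (𝔬 i).Dstar U))
    (hl2N : ∀ (i : I) (U : (bg i).Cfg),
      (L2ReadsNbr (R := R₀ i) (H := H₀ i) (GD i) 0 U (Rel i) r Cev (𝔬 i).blk (𝔬 i).blk (ev i) ((𝔬 i).G U) ∧
        L2ReadsNbr (R := R₀ i) (H := H₀ i) (GD i) 1 U (Rel i) r Cev (𝔬 i).blkY (𝔬 i).blk (ev i) ((𝔬 i).D U ∘ₗ (𝔬 i).G U) ∧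
        L2ReadsNbr (R := R₀ i) (H := H₀ i) (GD i) 2 U (Rel i) r Cev (𝔬 i).blk (𝔬 i).blkY (evY i) ((𝔬 i).G U ∘ₗ (𝔬 i).Dstar U) ∧
        L2ReadsNbr (R := R₀ i) (H := H₀ i) (GD i) 3 U (Rel i) r Cev ((𝔬 i).blk ∘ Prod.fst) (𝔬 i).blk (ev i)
          (familyOp (fun q : P × P => Dd i U q.1 ∘ₗ ((𝔬 i).G U ∘ₗ Dds i U q.2))) ∧
        L2ReadsNbr (R := R₀ i) (H := H₀ i) (GD i) 4 U (Rel i) r Cev ((𝔬 i).blk ∘ Prod.fst) (𝔬 i).blk (ev i)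
          (familyOp (fun q : P × P => (Dd i U q.1 ∘ₗ Dd i U q.2) ∘ₗ (𝔬 i).G U)) ∧
        L2ReadsNbr (R := R₀ i) (H := H₀ i) (GD i) 5 U (Rel i) r Cev ((𝔬 i).blk ∘ Prod.fst) (𝔬 i).blk (ev i)
          (familyOp (fun q : P × P => (𝔬 i).G U ∘ₗ (Dds i U q.1 ∘ₗ Dds i U q.2)))) ∧
      (L2ReadsNbr (R := R₀ i) (H := H₀ i) (G₁ i) 0 U (Rel i) r Cev (𝔬 i).blk (𝔬 i).blk (ev i) ((𝔬 i).G1 U) ∧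
        L2ReadsNbr (R := R₀ i) (H := H₀ i) (G₁ i) 1 U (Rel i) r Cev (𝔬 i).blkY (𝔬 i).blk (ev i) ((𝔬 i).D U ∘ₗ (𝔬 i).G1 U) ∧
        L2ReadsNbr (R := R₀ i) (H := H₀ i) (G₁ i) 2 U (Rel i) r Cev (𝔬 i).blk (𝔬 i).blkY (evY i) ((𝔬 i).G1 U ∘ₗ (𝔬 i).Dstar U) ∧
        L2ReadsNbr (R := R₀ i) (H := H₀ i) (G₁ i) 3 U (Rel i) r Cev ((𝔬 i).blk ∘ Prod.fst) (𝔬 i).blk (ev i)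
          (familyOp (fun q : P × P => Dd i U q.1 ∘ₗ ((𝔬 i).G1 U ∘ₗ Dds i U q.2))) ∧
        L2ReadsNbr (R := R₀ i) (H := H₀ i) (G₁ i) 4 U (Rel i) r Cev ((𝔬 i).blk ∘ Prod.fst) (𝔬 i).blk (ev i)
          (familyOp (fun q : P × P => (Dd i U q.1 ∘ₗ Dd i U q.2) ∘ₗ (𝔬 i).G1 U)) ∧
        L2ReadsNbr (R := R₀ i) (H := H₀ i) (G₁ i) 5 U (Rel i) r Cev ((𝔬 i).blk ∘ Prod.fst) (𝔬 i).blk (ev i)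
          (familyOp (fun q : P × P => (𝔬 i).G1 U ∘ₗ (Dds i U q.1 ∘ₗ Dds i U q.2)))))
    (hH1N : ∀ (i : I) (U : (bg i).Cfg),
      H1ReadsNbr (GD i) U (𝔭 i) (Rel i) r (𝔬 i).blk (𝔬 i).blkY (ev i) (evY i) ((𝔬 i).D U ∘ₗ (𝔬 i).G U)
        ((𝔬 i).G U ∘ₗ (𝔬 i).Dstar U) ∧
      H1ReadsNbr (G₁ i) U (𝔭 i) (Rel i) r (𝔬 i).blk (𝔬 i).blkY (ev i) (evY i) ((𝔬 i).D U ∘ₗ (𝔬 i).G1 U)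
        ((𝔬 i).G1 U ∘ₗ (𝔬 i).Dstar U))
    (hIF : ∀ (i : I) (U : (bg i).Cfg),
      InputReadsFam (GD i) U (bHX i) r ((𝔬 i).blk ∘ Prod.fst) ((𝔭 i).blkPX ∘ Prod.fst) (fun β => sliceProbe ((𝔭 i).ΦX U β)) (ev i)
        (familyOp (fun q : P × P => Dd i U q.1 ∘ₗ ((𝔬 i).G U ∘ₗ Dds i U q.2))) ∧
      InputReadsFam (G₁ i) U (bHX i) r ((𝔬 i).blk ∘ Prod.fst) ((𝔭 i).blkPX ∘ Prod.fst) (fun β => sliceProbe ((𝔭 i).ΦX U β)) (ev i)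
        (familyOp (fun q : P × P => Dd i U q.1 ∘ₗ ((𝔬 i).G1 U ∘ₗ Dds i U q.2))))
    (hHCN : ∀ (i : I) (U : (bg i).Cfg),
      CoReadsHHolderNbr (Hk i) U d (𝔭 i) r (𝔬 i).blkZ ((𝔬 i).D U ∘ₗ (𝔬 i).Hm U) ∧
      CoReadsHHolderNbr (H₁k i) U d (𝔭 i) r (𝔬 i).blkZ ((𝔬 i).D U ∘ₗ (𝔬 i).H1m U))
    (hsym : ∀ i, M₁ ≤ (geo i).M → ∀ α₀ : ℝ, 0 < α₀ → (geo i).M * α₀ ≤ a₁ →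
      ∀ U : (bg i).Cfg, (bg i).Reg335 c35 α₀ U → (bg i).Reg336 c35 α₀ U →
        (IsTransposePair ((𝔬 i).G U) ((𝔬 i).G U) ∧ IsTransposePair ((𝔬 i).G1 U) ((𝔬 i).G1 U)) ∧
        (IsTransposePair ((𝔬 i).D U ∘ₗ (𝔬 i).G U) ((𝔬 i).G U ∘ₗ (𝔬 i).Dstar U) ∧
          IsTransposePair ((𝔬 i).D U ∘ₗ (𝔬 i).G1 U) ((𝔬 i).G1 U ∘ₗ (𝔬 i).Dstar U)))
    (hmodel : ∀ i, M₁ ≤ (geo i).M → ∀ α₀ : ℝ, 0 < α₀ → (geo i).M * α₀ ≤ a₁ →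
      ∀ U : (bg i).Cfg, (bg i).Reg335 c35 α₀ U → (bg i).Reg336 c35 α₀ U →
        Thm33G0 (𝔬 i) (R₀ i) (H₀ i) B₀ δ₀ U ∧
        Step (𝔬 i) (R₀ i) (H₀ i) (hgeo i).lenle 1 (θ₁ * ((geo i).M * α₀)) δK U ∧
        Step (𝔬 i) (R₀ i) (H₀ i) (hgeo i).lenle 2 (θ₁ * ((geo i).M * α₀)) δK U ∧
        FormSmall (𝔬 i) (r₁ * ((geo i).M * α₀)) U ∧ Identities (𝔬 i) U)
    (hleft : ∀ i, M₁ ≤ (geo i).M → ∀ α₀ : ℝ, 0 < α₀ → (geo i).M * α₀ ≤ a₁ →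
      ∀ U : (bg i).Cfg, (bg i).Reg335 c35 α₀ U → (bg i).Reg336 c35 α₀ U →
        LeftStep (𝔬 i) (R₀ i) (H₀ i) (hgeo i).lenle B₀ δ₀ (θD * ((geo i).M * α₀)) δK U)
    (bZ : ∀ i, BlockNorm (toB6 (geo i) (R₀ i) (H₀ i)) (Z i → ℝ)) (hκZ : ∀ i, (bZ i).κ = 1)
    (hlettersH : ∀ i, M₁ ≤ (geo i).M → ∀ α₀ : ℝ, 0 < α₀ → (geo i).M * α₀ ≤ a₁ →
      ∀ U : (bg i).Cfg, (bg i).Reg335 c35 α₀ U → (bg i).Reg336 c35 α₀ U →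
        LettersHZ (𝔬 i) (R₀ i) (H₀ i) (hgeo i) (bZ i) B₃ δ₃ U)
    (hG0C : ∀ i, M₁ ≤ (geo i).M → ∀ α₀ : ℝ, 0 < α₀ → (geo i).M * α₀ ≤ a₁ →
      ∀ U : (bg i).Cfg, (bg i).Reg335 c35 α₀ U → (bg i).Reg336 c35 α₀ U →
        Thm33G0Dir (𝔬 i) (𝔭 i) (Dd i) (Dds i) (R₀ i) (H₀ i) (bHX i) B₀ Bh Bi Bi2 δ₀ U ∧
          Thm33G0L2M (𝔬 i) (Dd i) (Dds i) (R₀ i) (H₀ i) B₂ δ₀ U)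
    (hstepC : ∀ i, M₁ ≤ (geo i).M → ∀ α₀ : ℝ, 0 < α₀ → (geo i).M * α₀ ≤ a₁ →
      ∀ U : (bg i).Cfg, (bg i).Reg335 c35 α₀ U → (bg i).Reg336 c35 α₀ U →
        StepDirB (𝔬 i) (𝔭 i) (Dd i) (Dds i) (R₀ i) (H₀ i) (bHX i) (hgeo i).lenle (θD * ((geo i).M * α₀))
          (fun β => θH β * ((geo i).M * α₀)) (fun ε => θI ε * ((geo i).M * α₀)) δK U ∧
        StepL2 (𝔬 i) (R₀ i) (H₀ i) (θ₂ * ((geo i).M * α₀)) δK U)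
    (hLHH : ∀ i, M₁ ≤ (geo i).M → ∀ α₀ : ℝ, 0 < α₀ → (geo i).M * α₀ ≤ a₁ →
      ∀ U : (bg i).Cfg, (bg i).Reg335 c35 α₀ U → (bg i).Reg336 c35 α₀ U →
        LettersHHZ (𝔬 i) (𝔭 i) (R₀ i) (H₀ i) (hgeo i).lenle (bZ i) Bq δ₃ U) :
    B9.Thm312Printed d c35 geo bg GD G₁ Hk H₁k (fun i => HasRWExpOfOps (𝔬 i)) (fun i => HasRWExpHOfOps (𝔬 i))
      (fun i => PosDefKOfOps (𝔬 i)) := by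
  -- thresholds and uniform constants
  obtain ⟨MLg, cg, hLg⟩ := hL21 ρ hρ
  set M₁' : ℝ := max (max M₁ ML) MLg with hM₁'
  have hM₁'pos : 0 < M₁' := lt_max_of_lt_left (lt_max_of_lt_left hM₁)
  have hle₁ : ∀ {i : I}, M₁' ≤ (geo i).M → M₁ ≤ (geo i).M := fun h => ((le_max_left _ _).trans (le_max_left _ _)).trans h
  have hleL : ∀ {i : I}, M₁' ≤ (geo i).M → ML ≤ (geo i).M := fun h => ((le_max_right _ _).trans (le_max_left _ _)).trans h
  have hleg : ∀ {i : I}, M₁' ≤ (geo i).M → MLg ≤ (geo i).M := fun h => (le_max_right _ _).trans h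
  have hθc : 0 ≤ θ₁ * c := mul_nonneg hθ₁ hc
  have hB₂c : 0 ≤ B₂ * θ₂ * c * c := mul_nonneg (mul_nonneg (mul_nonneg hB₂ hθ₂) hc) hc
  set a₁' : ℝ := min a₁ (min (2 * (θ₁ * c + 1))⁻¹ (2 * (B₂ * θ₂ * c * c + 1))⁻¹) with ha₁'
  have ha₁'pos : 0 < a₁' := lt_min ha₁ (lt_min (inv_pos.mpr (by linarith)) (inv_pos.mpr (by linarith)))
  have ha₁'le : a₁' ≤ a₁ := min_le_left _ _
  have h1α : 0 < 1 - α := by linarith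
  have hB33 : 0 ≤ B₃ * B₃ * c := mul_nonneg (mul_nonneg hB₃ hB₃) hc
  have hLc0 : 0 ≤ Lc := zero_le_one.trans hLc
  have hLc2 : 0 ≤ Lc ^ (2 : ℝ) := Real.rpow_nonneg hLc0 _
  set Λu : ℝ := Lc ^ (4 : ℝ) with hΛu
  have hΛu0 : 0 ≤ Λu := Real.rpow_nonneg hLc0 _
  set tH : ℝ → ℝ := fun β => θH β * a₁ with htH
  have htH0 : ∀ β, 0 ≤ β → β < 1 → 0 ≤ tH β := fun β h0 h1 => mul_nonneg (hθH β h0 h1) ha₁.le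
  set tI : ℝ → ℝ := fun ε => θI ε * a₁ with htI
  have htI0 : ∀ ε, 0 < ε → 0 ≤ tI ε := fun ε hε => mul_nonneg (hθI ε hε) ha₁.le
  have hmax0 : ∀ ε β, 0 < ε → 0 ≤ β → β < 1 → 0 ≤ max (θH β) (θI (β + ε)) := fun ε β hε h0 h1 =>
    le_max_of_le_left (hθH β h0 h1)
  set tM : ℝ → ℝ → ℝ := fun ε β => max (θH β) (θI (β + ε)) * a₁ with htM
  have htM0 : ∀ ε β, 0 < ε → 0 ≤ β → β < 1 → 0 ≤ tM ε β := fun ε β hε h0 h1 => mul_nonneg (hmax0 ε β hε h0 h1) ha₁.le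
  set BL : ℝ := B₀ + θD * a₁ * (2 * B₀) * c with hBL
  have hBL0 : 0 ≤ BL := add_nonneg hB₀ (mul_nonneg (mul_nonneg (mul_nonneg hθD ha₁.le) (by linarith)) hc)
  set NP : ℝ := Real.sqrt (Fintype.card (P × P)) with hNP
  have hNP0 : 0 ≤ NP := Real.sqrt_nonneg _
  set KLu : ℝ := 2 * B₀ * Λu + (B₀ + θD * a₁ * (2 * B₀) * c + 2 * B₀) * Λu +
    (B₂ + B₂ * (θ₂ * a₁ * (2 * B₂) * c) * c) * (1 + NP * Λu + NP * Λu) with hKLu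
  have hm00 : (0 : ℝ) ≤ m := Nat.cast_nonneg m
  have hmN0 : (0 : ℝ) ≤ mN := Nat.cast_nonneg mN
  set Fr : ℝ := (mN : ℝ) * m * Cev * CL ^ 2 * Real.exp (r * ρf) with hFr
  have hFr0 : 0 ≤ Fr := mul_nonneg (mul_nonneg (mul_nonneg (mul_nonneg hmN0 hm00) hCev) (sq_nonneg _)) (Real.exp_nonneg _)
  set BL2 : ℝ := max (Fr * KLu) 0 with hBL2
  have hBL20 : 0 ≤ BL2 := le_max_right _ _
  -- the uniform Hölder constants (the first one also serves the Hölder member of (3.133))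
  set CH3 : ℝ := CL ^ 2 * Real.exp (r * ((1 - α) * ρ)) with hCH3
  have hCH30 : 0 ≤ CH3 := mul_nonneg (sq_nonneg _) (Real.exp_nonneg _)
  set BβH : ℝ → ℝ := fun β => CH3 * ((Bq β * B₃ * c + tH β * (2 * (B₃ * B₃ * c)) * c) * Lc ^ (2 : ℝ)) with hBβH
  have hBβH0 : ∀ β, 0 ≤ β → β < 1 → 0 ≤ BβH β := fun β h0 h1 =>
    mul_nonneg hCH30 (mul_nonneg (add_nonneg (mul_nonneg (mul_nonneg (hBq β) hB₃) hc)
      (mul_nonneg (mul_nonneg (htH0 β h0 h1) (by linarith)) hc)) hLc2)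
  set Bβo : ℝ → ℝ := fun β => max (max ((m : ℝ) * CL * Real.exp (r * ρf) * (Bh β + tH β * (2 * B₀) * c)) (BβH β)) 0 with hBβo
  have hBβo0 : ∀ β, 0 ≤ Bβo β := fun β => le_max_right _ _
  set Bεo : ℝ → ℝ := fun ε => max (Real.exp (r * ρf) * (Bi ε + BL * Λu * tI ε * c)) 0 with hBεo
  have hBεo0 : ∀ ε, 0 ≤ Bεo ε := fun ε => le_max_right _ _
  set Bεβo : ℝ → ℝ → ℝ := fun ε β =>
    max (CL * Real.exp (r * ρf) * (Bi2 ε β + (Bh β + tM ε β * (2 * B₀) * c) * Λu * tM ε β * c)) 0 with hBεβo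
  have hBεβo0 : ∀ ε β, 0 ≤ Bεβo ε β := fun ε β => le_max_right _ _
  refine thm312Printed_of_stepRelHZ 𝔬 R₀ H₀ GD G₁ Hk H₁k ev evY Rel m θ₁ θD r₁ B₀ δ₀ δK σ c ρ a₁' M₁' ML BL2 ρf B₃ δ₃ α Lc Bβo
    Bεo Bεβo hθ₁ hθD hr₁ hB₀ hB₃ hσ hρ hρS hρδ hρ₃ hc ha₁'pos hM₁'pos hρf hα hBβo0 hBεo0 hBεβo0 hgeo S hL1 hLle hη hrow hL21 hsat
    hmult hRdist hRlen hcoR hco1R hcoHR hcoG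
    (fun i hM α₀ hα₀ hMa U hU hU' => hmodel i (hle₁ hM) α₀ hα₀ (hMa.trans ha₁'le) U hU hU')
    (fun i hM α₀ hα₀ hMa U hU hU' => hleft i (hle₁ hM) α₀ hα₀ (hMa.trans ha₁'le) U hU hU') bZ hκZ
    (fun i hM α₀ hα₀ hMa U hU hU' => hlettersH i (hle₁ hM) α₀ hα₀ (hMa.trans ha₁'le) U hU hU') ?_
  -- the residual, PROVED per member and per configuration
  intro i hM α₀ hα₀ hMa U hU hU'
  have hM₁i : M₁ ≤ (geo i).M := hle₁ hM
  have hMpos : 0 < (geo i).M := hM₁.trans_le hM₁i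
  have hm0 : 0 ≤ (geo i).M * α₀ := (mul_pos hMpos hα₀).le
  have hma₁ : (geo i).M * α₀ ≤ a₁ := hMa.trans ha₁'le
  have hmθ : (geo i).M * α₀ ≤ (2 * (θ₁ * c + 1))⁻¹ := hMa.trans ((min_le_right _ _).trans (min_le_left _ _))
  have hm₂ : (geo i).M * α₀ ≤ (2 * (B₂ * θ₂ * c * c + 1))⁻¹ := hMa.trans ((min_le_right _ _).trans (min_le_right _ _))
  obtain ⟨h33, hS1, hS2, -, hI⟩ := hmodel i hM₁i α₀ hα₀ hma₁ U hU hU'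
  have hLS := hleft i hM₁i α₀ hα₀ hma₁ U hU hU'
  have hLH := hlettersH i hM₁i α₀ hα₀ hma₁ U hU hU'
  obtain ⟨hH0, hL2s⟩ := hG0C i hM₁i α₀ hα₀ hma₁ U hU hU'
  obtain ⟨hStH, hStL⟩ := hstepC i hM₁i α₀ hα₀ hma₁ U hU hU'
  have hHH := hLHH i hM₁i α₀ hα₀ hma₁ U hU hU'
  have hrowi := hrow i (hleL hM)
  obtain ⟨h260, -, hsize⟩ := hLg i (hleg hM)
  obtain ⟨⟨hlD0, hlD1, hlD2, hlD3, hlD4, hlD5⟩, ⟨hl10, hl11, hl12, hl13, hl14, hl15⟩⟩ := hl2N i U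
  obtain ⟨hH1D, hH11⟩ := hH1N i U
  obtain ⟨hIRD, hIR1⟩ := hIF i U
  obtain ⟨hHC0, hHC1⟩ := hHCN i U
  obtain ⟨⟨hsymG, hsymG1⟩, ⟨htrG, htrG1⟩⟩ := hsym i hM₁i α₀ hα₀ hma₁ U hU hU'
  have hlen := (hgeo i).lenle
  -- the second-argument saturation of d from the first-argument one and the symmetry of d
  have hRd₂ : ∀ a b b' : (geo i).Site, Rel i b b' → (geo i).dist a b = (geo i).dist a b' := fun a b b' h => by
    rw [(hgeo i).symm a b, (hgeo i).symm a b', hRdist i b b' a h]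
  set θ : ℝ := θ₁ * ((geo i).M * α₀) with hθdef
  set θ' : ℝ := θD * ((geo i).M * α₀) with hθ'def
  set θH' : ℝ → ℝ := fun β => θH β * ((geo i).M * α₀) with hθH'def
  set θI' : ℝ → ℝ := fun ε => θI ε * ((geo i).M * α₀) with hθI'def
  set θ₂' : ℝ := θ₂ * ((geo i).M * α₀) with hθ₂'def
  have hθ : 0 ≤ θ := mul_nonneg hθ₁ hm0
  have hθ' : 0 ≤ θ' := mul_nonneg hθD hm0
  have hθH' : ∀ β, 0 ≤ β → β < 1 → 0 ≤ θH' β := fun β h0 h1 => mul_nonneg (hθH β h0 h1) hm0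
  have hθI' : ∀ ε, 0 < ε → 0 ≤ θI' ε := fun ε hε => mul_nonneg (hθI ε hε) hm0
  have hθM' : ∀ ε β, 0 < ε → 0 ≤ β → β < 1 → 0 ≤ max (θH' β) (θI' (β + ε)) := fun ε β hε h0 h1 =>
    le_max_of_le_left (hθH' β h0 h1)
  have hθ₂' : 0 ≤ θ₂' := mul_nonneg hθ₂ hm0
  have hq : θ * c ≤ 1 / 2 := by
    have h := small_aux₁₅z hθc hmθ
    calc θ * c = θ₁ * c * ((geo i).M * α₀) := by rw [hθdef]; ring
      _ ≤ 1 / 2 := h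
  have hq1 : θ * c < 1 := lt_one_of_le_half hq
  have hq₂ : B₂ * θ₂' * c * c ≤ 1 / 2 := by
    have h := small_aux₁₅z hB₂c hm₂
    calc B₂ * θ₂' * c * c = B₂ * θ₂ * c * c * ((geo i).M * α₀) := by rw [hθ₂'def]; ring
      _ ≤ 1 / 2 := h
  have hq₂1 : B₂ * θ₂' * c * c < 1 := lt_one_of_le_half hq₂
  have hinv0 : 0 ≤ (1 - θ * c)⁻¹ := inv_nonneg.mpr (sub_nonneg.mpr hq1.le)
  have hinv2 : (1 - θ * c)⁻¹ ≤ 2 := inv_one_sub_le_two hq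
  have hC0 : 0 ≤ B₀ * (1 - θ * c)⁻¹ := mul_nonneg hB₀ hinv0
  have hθ'le : θ' ≤ θD * a₁ := mul_le_mul_of_nonneg_left hma₁ hθD
  have hθH'le : ∀ β, 0 ≤ β → β < 1 → θH' β ≤ tH β := fun β h0 h1 => mul_le_mul_of_nonneg_left hma₁ (hθH β h0 h1)
  have hθI'le : ∀ ε, 0 < ε → θI' ε ≤ tI ε := fun ε hε => mul_le_mul_of_nonneg_left hma₁ (hθI ε hε)
  have hθM'le : ∀ ε β, 0 < ε → 0 ≤ β → β < 1 → max (θH' β) (θI' (β + ε)) ≤ tM ε β := fun ε β hε h0 h1 => by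
    have e : max (θH' β) (θI' (β + ε)) = max (θH β) (θI (β + ε)) * ((geo i).M * α₀) :=
      (max_mul_of_nonneg _ _ hm0).symm
    rw [e]
    exact mul_le_mul_of_nonneg_left hma₁ (hmax0 ε β hε h0 h1)
  have hθ₂'le : θ₂' ≤ θ₂ * a₁ := mul_le_mul_of_nonneg_left hma₁ hθ₂
  have hC1L : B₀ + θ' * (B₀ * (1 - θ * c)⁻¹) * c ≤ BL := by
    have h2 : θ' * (B₀ * (1 - θ * c)⁻¹) ≤ θD * a₁ * (2 * B₀) :=
      mul_le_mul hθ'le (const_le_two_mul hB₀ hq) hC0 (mul_nonneg hθD ha₁.le)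
    have h3 : θ' * (B₀ * (1 - θ * c)⁻¹) * c ≤ θD * a₁ * (2 * B₀) * c := mul_le_mul_of_nonneg_right h2 hc
    rw [hBL]; linarith
  -- the scale transfers of p. 398 at (ρ, α) and the uniform bound of their constants
  have hL0i : 0 < (geo i).L := lt_of_lt_of_le one_pos (hL1 i)
  have hL4 : (geo i).L ^ (4 : ℝ) ≤ Λu := Real.rpow_le_rpow hL0i.le (hLle i) (by norm_num)
  have hST : ∀ γ : ℝ, |γ| ≤ 4 → ScaleTransfer (geo i) ρ α ((geo i).L ^ |γ|) (fun y => (geo i).len y ^ γ) ∧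
      0 ≤ (geo i).L ^ |γ| ∧ (geo i).L ^ |γ| ≤ Λu := fun γ hγ =>
    ⟨scaleTransfer_rpow_of_260 h260 hsize (hL1 i) (hη i) γ hγ, Real.rpow_nonneg hL0i.le _,
      (B9Ineq347AllEntries.size_condition_compact (geo i).L γ _ (hL1 i) hγ hsize).2.trans hL4⟩
  obtain ⟨hST1, hΛ₁0, hΛ₁le⟩ := hST 1 (by norm_num)
  have hΛ₁1 : 1 ≤ (geo i).L ^ |(1 : ℝ)| := Real.one_le_rpow (hL1 i) (abs_nonneg _)
  obtain ⟨hSTh, hΛh0, hΛhle⟩ := hST (1 / 2) (by rw [abs_of_nonneg (by norm_num : (0 : ℝ) ≤ 1 / 2)]; norm_num)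
  obtain ⟨hSTm, hΛm0, hΛmle⟩ := hST (-1) (by norm_num)
  have hST2 : ScaleTransfer (geo i) ρ α (Lc ^ (2 : ℝ)) (fun y => (geo i).len y ^ (2 : ℝ)) := by
    obtain ⟨h2, _, _⟩ := hST 2 (by norm_num)
    have hΛle : (geo i).L ^ |(2 : ℝ)| ≤ Lc ^ (2 : ℝ) := by
      rw [abs_of_pos (by norm_num : (0 : ℝ) < 2)]
      exact Real.rpow_le_rpow hL0i.le (hLle i) (by norm_num)
    exact fun y y' => (h2 y y').trans (mul_le_mul_of_nonneg_right hΛle (B9Ineq347AllEntries.weight_nonneg (geo i) hL0i (hη i) 2 y))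
  -- the uniform bounds of the member constants of the two blocks
  have hKL : constL2N B₀ θ θ' B₂ θ₂' c ((geo i).L ^ |(1 : ℝ)|) ((geo i).L ^ |(1 / 2 : ℝ)|) ((geo i).L ^ |(-1 : ℝ)|) NP ≤ KLu :=
    constL2N_le hB₀ hB₂ hc hθ' hθ'le hθ₂' hθ₂'le hq hq₂ hNP0 hΛ₁0 hΛ₁le hΛh0 hΛhle hΛm0 hΛmle
  have hKL2 : Fr * constL2N B₀ θ θ' B₂ θ₂' c ((geo i).L ^ |(1 : ℝ)|) ((geo i).L ^ |(1 / 2 : ℝ)|) ((geo i).L ^ |(-1 : ℝ)|) NP ≤ BL2 :=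
    (mul_le_mul_of_nonneg_left hKL hFr0).trans (le_max_left _ _)
  have hBhA : ∀ β, 0 ≤ β → β < 1 → Bh β + θH' β * (B₀ * (1 - θ * c)⁻¹) * c ≤ Bh β + tH β * (2 * B₀) * c := fun β h0 h1 => by
    have h := mul_le_mul_of_nonneg_right (mul_le_mul (hθH'le β h0 h1) (const_le_two_mul hB₀ hq) hC0 (htH0 β h0 h1)) hc
    linarith
  have hBhM : ∀ ε β, 0 < ε → 0 ≤ β → β < 1 →
      Bh β + max (θH' β) (θI' (β + ε)) * (B₀ * (1 - θ * c)⁻¹) * c ≤ Bh β + tM ε β * (2 * B₀) * c := fun ε β hε h0 h1 => by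
    have h := mul_le_mul_of_nonneg_right
      (mul_le_mul (hθM'le ε β hε h0 h1) (const_le_two_mul hB₀ hq) hC0 (htM0 ε β hε h0 h1)) hc
    linarith
  have hmCE : 0 ≤ (m : ℝ) * CL * Real.exp (r * ρf) := mul_nonneg (mul_nonneg hm00 (zero_le_one.trans hCL1)) (Real.exp_nonneg _)
  have hβo : ∀ β, 0 ≤ β → β < 1 →
      (m : ℝ) * CL * Real.exp (r * ρf) * (Bh β + θH' β * (B₀ * (1 - θ * c)⁻¹) * c) ≤ Bβo β ∧ 0 ≤ Bβo β := fun β h0 h1 =>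
    ⟨((mul_le_mul_of_nonneg_left (hBhA β h0 h1) hmCE).trans (le_max_left _ _)).trans (le_max_left _ _), hBβo0 β⟩
  have hεo : ∀ ε, 0 < ε → ε ≤ 1 →
      Real.exp (r * ρf) * (Bi ε + (B₀ + θ' * (B₀ * (1 - θ * c)⁻¹) * c) * (geo i).L ^ |(1 : ℝ)| * θI' ε * c) ≤ Bεo ε ∧
        0 ≤ Bεo ε := by
    intro ε h0 h1
    have h : (B₀ + θ' * (B₀ * (1 - θ * c)⁻¹) * c) * (geo i).L ^ |(1 : ℝ)| * θI' ε * c ≤ BL * Λu * tI ε * c :=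
      mul_le_mul_of_nonneg_right (mul_le_mul (mul_le_mul hC1L hΛ₁le hΛ₁0 hBL0) (hθI'le ε h0) (hθI' ε h0)
        (mul_nonneg hBL0 hΛu0)) hc
    refine ⟨le_trans ?_ (le_max_left _ _), hBεo0 ε⟩
    exact mul_le_mul_of_nonneg_left (by linarith) (Real.exp_nonneg _)
  have hεβo : ∀ ε β, 0 < ε → ε ≤ 1 → 0 ≤ β → β < 1 →
      CL * Real.exp (r * ρf) * (Bi2 ε β + (Bh β + max (θH' β) (θI' (β + ε)) * (B₀ * (1 - θ * c)⁻¹) * c) * (geo i).L ^ |(1 : ℝ)| *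
          max (θH' β) (θI' (β + ε)) * c) ≤ Bεβo ε β ∧ 0 ≤ Bεβo ε β := by
    intro ε β hε0 hε1 h0 h1
    have hA0 : 0 ≤ Bh β + max (θH' β) (θI' (β + ε)) * (B₀ * (1 - θ * c)⁻¹) * c :=
      add_nonneg (hBh β h0 h1) (mul_nonneg (mul_nonneg (hθM' ε β hε0 h0 h1) hC0) hc)
    have hA1 : 0 ≤ Bh β + tM ε β * (2 * B₀) * c := hA0.trans (hBhM ε β hε0 h0 h1)
    have h : (Bh β + max (θH' β) (θI' (β + ε)) * (B₀ * (1 - θ * c)⁻¹) * c) * (geo i).L ^ |(1 : ℝ)| *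
        max (θH' β) (θI' (β + ε)) * c ≤ (Bh β + tM ε β * (2 * B₀) * c) * Λu * tM ε β * c :=
      mul_le_mul_of_nonneg_right (mul_le_mul (mul_le_mul (hBhM ε β hε0 h0 h1) hΛ₁le hΛ₁0 hA1) (hθM'le ε β hε0 h0 h1)
        (hθM' ε β hε0 h0 h1) (mul_nonneg hA1 hΛu0)) hc
    refine ⟨le_trans ?_ (le_max_left _ _), hBεβo0 ε β⟩
    exact mul_le_mul_of_nonneg_left (by linarith) (mul_nonneg (zero_le_one.trans hCL1) (Real.exp_nonneg _))
  -- the two blocks of a kernel family co-read by A ∈ {G, G₁} (with (Δ_a − T)A = I), proved and weakened to the uniform constants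
  have resK : ∀ (K : B9.KernelFamily (geo i) (bg i)) (A T : Module.End ℝ (X i → ℝ)), ((𝔬 i).S0 U - T) * A = 1 →
      HasMaj (cNorm (R₀ i) (H₀ i) (𝔬 i).blk (hgeo i).lenle 1) (cNorm (R₀ i) (H₀ i) (𝔬 i).blk (hgeo i).lenle 1) ((𝔬 i).G0 U ∘ₗ T)
        (fun a b => θ * Real.exp (-(δK * (geo i).dist a b))) →
      HasMaj (cNorm (R₀ i) (H₀ i) (𝔬 i).blk (hgeo i).lenle 2) (cNorm (R₀ i) (H₀ i) (𝔬 i).blk (hgeo i).lenle 2) ((𝔬 i).G0 U ∘ₗ T)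
        (fun a b => θ * Real.exp (-(δK * (geo i).dist a b))) →
      HasMaj (cNorm (R₀ i) (H₀ i) (𝔬 i).blk (hgeo i).lenle 2) (cNorm (R₀ i) (H₀ i) (𝔬 i).blkY (hgeo i).lenle 1)
        ((𝔬 i).D U ∘ₗ (𝔬 i).G0 U ∘ₗ T) (fun a b => θ' * Real.exp (-(δK * (geo i).dist a b))) →
      (∀ ν : P, HasMaj (cNorm (R₀ i) (H₀ i) (𝔬 i).blk (hgeo i).lenle 2) (cNorm (R₀ i) (H₀ i) (𝔬 i).blk (hgeo i).lenle 1)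
        (Dd i U ν ∘ₗ (𝔬 i).G0 U ∘ₗ T) (fun a b => θ' * Real.exp (-(δK * (geo i).dist a b)))) →
      (∀ β : ℝ, 0 ≤ β → β < 1 → HasMaj (cNormR (R₀ i) (H₀ i) (𝔬 i).blk (hgeo i).lenle (-2))
        (cNormR (R₀ i) (H₀ i) (𝔭 i).blkPY (hgeo i).lenle (β - 1)) (((𝔭 i).ΦY U β ∘ₗ (𝔬 i).D U ∘ₗ (𝔬 i).G0 U) ∘ₗ T)
        (fun a b => θH' β * Real.exp (-(δK * (geo i).dist a b)))) →
      (∀ β : ℝ, 0 ≤ β → β < 1 → HasMaj (cNormR (R₀ i) (H₀ i) (𝔬 i).blk (hgeo i).lenle (-1))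
        (cNormR (R₀ i) (H₀ i) (𝔭 i).blkPX (hgeo i).lenle (β - 1)) (((𝔭 i).ΦX U β ∘ₗ (𝔬 i).G0 U) ∘ₗ T)
        (fun a b => θH' β * Real.exp (-(δK * (geo i).dist a b)))) →
      (∀ (ν : P) (β : ℝ), 0 ≤ β → β < 1 → HasMaj (cNormR (R₀ i) (H₀ i) (𝔬 i).blk (hgeo i).lenle (-2))
        (cNormR (R₀ i) (H₀ i) (𝔭 i).blkPX (hgeo i).lenle (β - 1)) (((𝔭 i).ΦX U β ∘ₗ Dd i U ν ∘ₗ (𝔬 i).G0 U) ∘ₗ T)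
        (fun a b => θH' β * Real.exp (-(δK * (geo i).dist a b)))) →
      (∀ (μ : P) (ε : ℝ), 0 < ε → HasMaj (bHX i ε) (cNormR (R₀ i) (H₀ i) (𝔬 i).blk (hgeo i).lenle 1)
        (T ∘ₗ ((𝔬 i).G0 U ∘ₗ Dds i U μ)) (fun a b => θI' ε * Real.exp (-(δK * (geo i).dist a b)))) →
      BlockBd (g := toB6 (geo i) (R₀ i) (H₀ i)) (𝔬 i).blk (𝔬 i).blk T
        (fun (y y' : (geo i).Site) => θ₂' * ((geo i).len y)⁻¹ * ((geo i).len y')⁻¹ * Real.exp (-(δK * (geo i).dist y y'))) →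
      IsTransposePair A A → IsTransposePair ((𝔬 i).D U ∘ₗ A) (A ∘ₗ (𝔬 i).Dstar U) →
      L2ReadsNbr (R := R₀ i) (H := H₀ i) K 0 U (Rel i) r Cev (𝔬 i).blk (𝔬 i).blk (ev i) A →
      L2ReadsNbr (R := R₀ i) (H := H₀ i) K 1 U (Rel i) r Cev (𝔬 i).blkY (𝔬 i).blk (ev i) ((𝔬 i).D U ∘ₗ A) →
      L2ReadsNbr (R := R₀ i) (H := H₀ i) K 2 U (Rel i) r Cev (𝔬 i).blk (𝔬 i).blkY (evY i) (A ∘ₗ (𝔬 i).Dstar U) →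
      L2ReadsNbr (R := R₀ i) (H := H₀ i) K 3 U (Rel i) r Cev ((𝔬 i).blk ∘ Prod.fst) (𝔬 i).blk (ev i)
        (familyOp (fun q : P × P => Dd i U q.1 ∘ₗ (A ∘ₗ Dds i U q.2))) →
      L2ReadsNbr (R := R₀ i) (H := H₀ i) K 4 U (Rel i) r Cev ((𝔬 i).blk ∘ Prod.fst) (𝔬 i).blk (ev i)
        (familyOp (fun q : P × P => (Dd i U q.1 ∘ₗ Dd i U q.2) ∘ₗ A)) →
      L2ReadsNbr (R := R₀ i) (H := H₀ i) K 5 U (Rel i) r Cev ((𝔬 i).blk ∘ Prod.fst) (𝔬 i).blk (ev i)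
        (familyOp (fun q : P × P => A ∘ₗ (Dds i U q.1 ∘ₗ Dds i U q.2))) →
      H1ReadsNbr K U (𝔭 i) (Rel i) r (𝔬 i).blk (𝔬 i).blkY (ev i) (evY i) ((𝔬 i).D U ∘ₗ A) (A ∘ₗ (𝔬 i).Dstar U) →
      InputReadsFam K U (bHX i) r ((𝔬 i).blk ∘ Prod.fst) ((𝔭 i).blkPX ∘ Prod.fst) (fun β => sliceProbe ((𝔭 i).ΦX U β)) (ev i)
        (familyOp (fun q : P × P => Dd i U q.1 ∘ₗ (A ∘ₗ Dds i U q.2))) →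
      L2Block K BL2 ρf U ∧ B9.Ineq343_345 K Bβo Bεo Bεβo ρf U := by
    intro K A T hIA hK1 hK2 hKD hsDd hpY hpX hpXd htDd hT2 hsymA htrA hl0 hl1 hl2 hl3 hl4 hl5 hH1 hIRA
    have hl2B := l2Block_of_step_pairM (hgeo i) (𝔬 i) (Dd i) (Dds i) (Rel i) (ev i) (evY i) hrowi hθ hθ' hθ₂' hB₀ hB₂ hσ hα0 hρ.le
      hρS hρδ hq1 hq₂1 hρf.le hρf1 hρf2 hΛ₁1 hΛh0 hΛm0 hST1 hSTh hSTm hI.invG0' hIA h33.e0 hLS.e1 h33.e2 hL2s hK1 hK2 hKD hT2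
      hsymA htrA hRd₂ (hmult i) (hnbr i) hCL1 (hCL i) hCev hl0 hl1 hl2 hl3 hl4 hl5
    have hHo := holder_of_step_pairMB (hgeo i) (𝔬 i) (𝔭 i) (Dd i) (Dds i) (bHX i) (Rel i) (ev i) (evY i) hrowi hθ hθ' hθH' hθI' hB₀
      hσ hα0 hρ.le hρS hρδ hq1 hρf.le hρf1 hΛ₁0 hBh hBi hBi2 hST1 hI.invG0' hIA h33.e0 h33.e2 hH0 hK1 hK2 hsDd hpY hpX hpXd htDd
      hRd₂ (hmult i) hCL1 (hCL i) hH1 hIRA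
    exact ⟨l2Block_mono (S i) hl2B hKL2 hBL20 le_rfl, ineq343_345_mono_on (S i) hHo (hgeo i).lenpos hβo hεo hεβo le_rfl⟩
  -- the Hölder member of (3.133) for H = A∘Q*∘C, proved and weakened to the uniform constant and the rate ρ_f ∕ 2
  have hfix := fix_of_inverses hI.invG0' hI.invG
  have hfix1 := fix_of_inverses hI.invG0' hI.invG1
  have hKH0 : 0 ≤ B₃ * B₃ * c * (1 - θ * c)⁻¹ := mul_nonneg hB33 hinv0
  have hH0m : HasMaj (cNorm (R₀ i) (H₀ i) (𝔬 i).blkZ (hgeo i).lenle 2) (cNorm (R₀ i) (H₀ i) (𝔬 i).blk (hgeo i).lenle 2) ((𝔬 i).Hm U)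
      (fun a b => B₃ * B₃ * c * (1 - θ * c)⁻¹ * Real.exp (-(ρ * (geo i).dist a b))) := by
    rw [hI.eq126]
    exact H_entry0Z (hgeo i) hrowi (hκZ i) hc hθ hB₃ hσ hρ.le hρ₃ hρδ hS2.step hLH.gQs2 hLH.c2 hfix hq1
  have hH10m : HasMaj (cNorm (R₀ i) (H₀ i) (𝔬 i).blkZ (hgeo i).lenle 2) (cNorm (R₀ i) (H₀ i) (𝔬 i).blk (hgeo i).lenle 2) ((𝔬 i).H1m U)
      (fun a b => B₃ * B₃ * c * (1 - θ * c)⁻¹ * Real.exp (-(ρ * (geo i).dist a b))) := by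
    rw [hI.eq129]
    exact H_entry0Z (hgeo i) hrowi (hκZ i) hc hθ hB₃ hσ hρ.le hρ₃ hρδ hS2.step1 hLH.gQs2 hLH.c12 hfix1 hq1
  have hα1 : α ≤ 1 := by linarith
  have resH : ∀ {Hk'' : B9.HKernel (geo i) (bg i)} (β : ℝ) (ζ : (geo i).Cut) (y y' : (geo i).Site), 0 ≤ β → β < 1 →
      (∀ (ζ : (geo i).Cut) (y y' : (geo i).Site), (geo i).cutInT ζ y →
        Hk''.h U β ζ y' ≤ (CL ^ 2 * Real.exp (r * ((1 - α) * ρ)) * ((Bq β * B₃ * c + θH' β * (B₃ * B₃ * c * (1 - θ * c)⁻¹) * c) *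
          Lc ^ (2 : ℝ))) * (geo i).cutH β ζ * ((geo i).len y) ^ (-(1 + β)) * ((geo i).len y') ^ (-(d : ℝ)) *
          Real.exp (-((1 - α) * ρ * (geo i).dist y y'))) →
      (geo i).cutInT ζ y →
      Hk''.h U β ζ y' ≤ Bβo β * (geo i).cutH β ζ * ((geo i).len y) ^ (-(1 + β)) * ((geo i).len y') ^ (-(d : ℝ)) *
        Real.exp (-(ρf / 2 * (geo i).dist y y')) := by
    intro Hk'' β ζ y y' hβ0 hβ1 h hζ
    refine (h ζ y y' hζ).trans ?_
    -- the member constant below the uniform one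
    have hCle : CL ^ 2 * Real.exp (r * ((1 - α) * ρ)) * ((Bq β * B₃ * c + θH' β * (B₃ * B₃ * c * (1 - θ * c)⁻¹) * c) *
        Lc ^ (2 : ℝ)) ≤ Bβo β := by
      have h1 : B₃ * B₃ * c * (1 - θ * c)⁻¹ ≤ 2 * (B₃ * B₃ * c) := by
        have := mul_le_mul_of_nonneg_left hinv2 hB33; linarith
      have h2 : θH' β * (B₃ * B₃ * c * (1 - θ * c)⁻¹) * c ≤ tH β * (2 * (B₃ * B₃ * c)) * c :=
        mul_le_mul_of_nonneg_right (mul_le_mul (hθH'le β hβ0 hβ1) h1 hKH0 (htH0 β hβ0 hβ1)) hc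
      have h3 : (Bq β * B₃ * c + θH' β * (B₃ * B₃ * c * (1 - θ * c)⁻¹) * c) * Lc ^ (2 : ℝ) ≤
          (Bq β * B₃ * c + tH β * (2 * (B₃ * B₃ * c)) * c) * Lc ^ (2 : ℝ) := mul_le_mul_of_nonneg_right (by linarith) hLc2
      exact ((mul_le_mul_of_nonneg_left h3 hCH30).trans (le_max_right _ _)).trans (le_max_left _ _)
    -- the rate ρ_f ∕ 2 below (1 − α)ρ
    have hrate : Real.exp (-((1 - α) * ρ * (geo i).dist y y')) ≤ Real.exp (-(ρf / 2 * (geo i).dist y y')) :=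
      Real.exp_le_exp.mpr (neg_le_neg (mul_le_mul_of_nonneg_right (by linarith) ((hgeo i).dnn y y')))
    have hnn : 0 ≤ (geo i).cutH β ζ * ((geo i).len y) ^ (-(1 + β)) * ((geo i).len y') ^ (-(d : ℝ)) :=
      mul_nonneg (mul_nonneg ((S i).cutH_nonneg β ζ) (Real.rpow_nonneg (hlen y) _)) (Real.rpow_nonneg (hlen y') _)
    calc CL ^ 2 * Real.exp (r * ((1 - α) * ρ)) * ((Bq β * B₃ * c + θH' β * (B₃ * B₃ * c * (1 - θ * c)⁻¹) * c) * Lc ^ (2 : ℝ)) *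
          (geo i).cutH β ζ * ((geo i).len y) ^ (-(1 + β)) * ((geo i).len y') ^ (-(d : ℝ)) * Real.exp (-((1 - α) * ρ * (geo i).dist y y'))
        = CL ^ 2 * Real.exp (r * ((1 - α) * ρ)) * ((Bq β * B₃ * c + θH' β * (B₃ * B₃ * c * (1 - θ * c)⁻¹) * c) * Lc ^ (2 : ℝ)) *
            ((geo i).cutH β ζ * ((geo i).len y) ^ (-(1 + β)) * ((geo i).len y') ^ (-(d : ℝ))) *
            Real.exp (-((1 - α) * ρ * (geo i).dist y y')) := by ring
      _ ≤ Bβo β * ((geo i).cutH β ζ * ((geo i).len y) ^ (-(1 + β)) * ((geo i).len y') ^ (-(d : ℝ))) *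
            Real.exp (-(ρf / 2 * (geo i).dist y y')) :=
          mul_le_mul (mul_le_mul_of_nonneg_right hCle hnn) hrate (Real.exp_nonneg _) (mul_nonneg (hBβo0 β) hnn)
      _ = Bβo β * (geo i).cutH β ζ * ((geo i).len y) ^ (-(1 + β)) * ((geo i).len y') ^ (-(d : ℝ)) *
            Real.exp (-(ρf / 2 * (geo i).dist y y')) := by ring
  refine ⟨fun K hK => ?_, fun Hk' hK' β ζ y y' h0 h1 hζ => ?_⟩
  · have hK2 : K = GD i ∨ K = G₁ i := by simpa using hK
    rcases hK2 with rfl | rfl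
    · exact resK _ _ _ hI.invG hS1.step hS2.step hLS.stepD hStH.sDd hStH.pY hStH.pX hStH.pXd hStH.tDd hStL.t hsymG htrG hlD0 hlD1
        hlD2 hlD3 hlD4 hlD5 hH1D hIRD
    · exact resK _ _ _ hI.invG1 hS1.step1 hS2.step1 hLS.stepD1 hStH.sDd1 hStH.pY1 hStH.pX1 hStH.pXd1 hStH.tDd1 hStL.t1 hsymG1 htrG1
        hl10 hl11 hl12 hl13 hl14 hl15 hH11 hIR1
  · have hK2 : Hk' = Hk i ∨ Hk' = H₁k i := by simpa using hK'
    rcases hK2 with rfl | rfl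
    · exact resH β ζ y y' h0 h1 (hkh_of_step_nbrZ (hgeo i) (𝔭 i) hrowi (hκZ i) (hθH' β h0 h1) (hBq β) hB₃ hKH0 hLc2 hσ hρ.le hρ₃ hρδ hα1 h0
        h1.le hHC0 hCL1 (hCL i) hST2 (hHH.pQ β h0 h1) hLH.c2 (hStH.pY β h0 h1) hH0m hI.eq126 hfix) hζ
    · exact resH β ζ y y' h0 h1 (hkh_of_step_nbrZ (hgeo i) (𝔭 i) hrowi (hκZ i) (hθH' β h0 h1) (hBq β) hB₃ hKH0 hLc2 hσ hρ.le hρ₃ hρδ hα1 h0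
        h1.le hHC1 hCL1 (hCL i) hST2 (hHH.pQ β h0 h1) hLH.c12 (hStH.pY1 β h0 h1) hH10m hI.eq129 hfix1) hζ

end Family

end

end Literature.MathematicalPhysics.QuantumFieldTheory.Balaban1983to89.B9Thm312WholeLeafCompletePairMBZ
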